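import Summits.BirchSwinnertonDyer.Rank1Residual.P2.CongruentNumberPairsAtTwoEvenAtlasThreeCensus
import Summits.BirchSwinnertonDyer.Rank1Residual.P2.GenusSumsFourPrimes
import Summits.BirchSwinnertonDyer.Rank1Residual.P2.CongruentNumberPairsAtTwoDoorAAtlasThree
import Summits.BirchSwinnertonDyer.Rank1Residual.P2.CongruentNumberPairsAtTwoEvenFiveFamily
import HarnessLib

/-!
# Sub-lane «bsd-p2»: the EVEN `ω(m) = 3` ATLAS, file 2/3 — TRANSFER: the prime triple's even Monsky
# matrix, the genus bit `g(2m)` and the printed second genus sum `Σ₂′(2p₀p₁p₂)` ARE the readings of its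
# Legendre configuration (file 1/3 `…EvenAtlasThreeCensus`)

HONEST FRAMING (sub-lane «bsd-p2», run/shared/lean/b2b/bsd-rank1-residual/p2/, verbatim in every
file): the target of record is the FULL Birch–Swinnerton-Dyer formula for EVERY analytic-rank `≤ 1`
`E/ℚ` at ALL primes INCLUDING `2`; the odd-prime class ledger is referee A's; the `2`-part is OPEN
(cells O1 = X5 ∖ CM and O12 = the CM corner) and under census by «bsd-p2». Census / instrument
output at `2` = EVIDENCE / conjecture items with held-out validation, NEVER a Literature fact;
certificates close PAIRS (one isogeny class, `p = 2`), never classes. This file asserts NO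
arithmetic fact: it proves IDENTITIES between the tree's objects for a tuple of distinct odd primes and
the configuration readings of file 1/3, the genus side modulo the displayed Rédei–Reichardt fact (`hR`,
Li–Ma 2008 Thm 0.4). Nothing booked; no mark moved; no `ℓ = 4` object occurs. Unit
`b2b-bsdres-p2-typer`: typer GEN 23 scratch @e80f739959244350 (T-164 rails); LANDED on p2-lead
GEN 12's WAKE-T-167 ORDER 3 (iii) as amended by p2-lead GEN 18 (ADDENDA 3, 5, 6), bytes pre-read by p2-ref GEN 73
(`p2/REFEREE.md` l.574); this provenance sentence refreshed before filing by T-199 (p2-typer GEN 66,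
`p2/typer/cn/refresh_docstring_t199.py`), Lean terms unchanged.

WHAT IT GIVES. (§1) `[(−1/b) = −1] = χ₄`, `[(8/q) = −1] = χ₈`, `[(−8/q) = −1] = χ₈ + χ₄` as residue bits;
(§2) `monskyMatrixEven p = monskyCfgEven (pᵢ mod 8) ([(p_b/p_a) = −1])` for distinct odd primes, hence the
kernel counts agree and `s = 1 ⟺` kernel `2`; (§3) `g(2·∏qᵢ) mod 2 = gBitCfgTwo` (Li–Ma's `RM(−8m)` on
`Option (Fin m)`: row of `2` = `[(±8/q_a) = −1]`, column of `2` = `[q_b ≡ ±3 (8)]`) and, for a triple with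
`2p₀p₁p₂ ≡ 6 (mod 8)`, `Σ₂′(2p₀p₁p₂) mod 2 = sigma2'CfgEven` — the fifteen-term `natCast_genusSum₂'_four`
(typer GEN 23 `GenusSumsFourPrimes`) at `q = 2`, each `g`-value transferred to its bit, each printed
pattern read on residues. File 3/3 (`…EvenAtlasThree`) draws the door and the sentence-level corollaries.

References: [HeathBrown1994SelmerCongruentII] Appendix (Monsky), typescript p. 41 L20–L36;
[TianYuanZhang2017] Thm 1.2, §1; [LiMa2008] Lemma 0.1, Def 0.2, Thm 0.4; [Cox2013] §5.B ((D/2));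
[IrelandRosen1990] Ch. 5 §1 Prop. 5.1.2–5.1.3, §2 Thm 1 and Prop. 5.2.2; HOME/p2/STRUCTURE-p2.md §7.
-/

noncomputable section

open scoped Classical

open Matrix Finset NumberField WeierstrassCurve Literature.NumberTheory.EllipticCurves
  Literature.NumberTheory.EllipticCurves.Rank1Residual
  Literature.NumberTheory.EllipticCurves.Rank1Residual.Typed
  Literature.NumberTheory.EllipticCurves.HeathBrown1994
  Literature.NumberTheory.EllipticCurves.HeathBrown1994.Families
  Literature.NumberTheory.EllipticCurves.TianYuanZhang2017
  Literature.NumberTheory.EllipticCurves.Tian2014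
  Literature.NumberTheory.QuadraticFields.RedeiReichardt

set_option autoImplicit false

namespace Summit.BirchSwinnertonDyer.Rank1Residual.P2

/-! ## §1 Symbols: `(−1/q)`, `(8/q)`, `(−8/q)` as residue bits -/

section Symbols

/-- `[(−1/b) = −1] = [b ≡ 3 (mod 4)]` for odd `b` (first supplement).
[cite: IrelandRosen1990, Ch. 5 §1 Prop. 5.1.2 Cor. and §2 Prop. 5.2.2] -/
theorem addLegendreSym_neg_one_eq {b : ℕ} (hb : Odd b) :
    addLegendreSym (-1) b = if b % 4 = 3 then 1 else 0 := by
  have hb4 : b % 4 = 1 ∨ b % 4 = 3 := by rcases hb with ⟨m, rfl⟩; omega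
  rcases hb4 with h | h
  · rw [if_neg (by omega)]; exact addLegendreSym_of_eq_one (jacobiSym_neg_one_eq_one h)
  · rw [if_pos h]
    apply addLegendreSym_of_eq_neg_one
    rw [jacobiSym.at_neg_one hb, ZMod.χ₄_nat_eq_if_mod_four]
    have h2 : b % 2 = 1 := by omega
    simp [h, h2]

/-- `[(8/q) = −1] = [(2/q) = −1] = [q ≡ ±3 (mod 8)]` for an odd prime `q` (second supplement).
[cite: IrelandRosen1990, Ch. 5 §2 Prop. 5.2.2 (second supplement)] -/
theorem kroneckerBit_eight_eq_chi8Bit {q : ℕ} (hq : q.Prime) (hq2 : q ≠ 2) :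
    kroneckerBit 8 q = chi8Bit q := by
  have hodd := Nat.odd_iff.mp (hq.odd_of_ne_two hq2)
  unfold chi8Bit
  by_cases h : q % 8 = 3 ∨ q % 8 = 5
  · rw [if_pos h]; exact kroneckerBit_eight_eq_one hq h
  · rw [if_neg h]; exact kroneckerBit_eight_eq_zero hq (by omega)

/-- `[(−8/q) = −1] = [(−2/q) = −1] = [q ≡ 5, 7 (mod 8)]` for an odd prime `q`.
[cite: IrelandRosen1990, Ch. 5 §2 Prop. 5.2.2 (supplements: (−2/q) = 1 iff q ≡ 1, 3 (mod 8))] -/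
theorem kroneckerBit_neg_eight_eq {q : ℕ} (hq : q.Prime) (hq2 : q ≠ 2) :
    kroneckerBit (-8) q = if q % 8 = 5 ∨ q % 8 = 7 then 1 else 0 := by
  have hodd : Odd q := hq.odd_of_ne_two hq2
  have hne : ((-8 : ℤ) : ZMod q) ≠ 0 := by
    intro h
    have h8 : ((8 : ℕ) : ZMod q) = 0 := by
      have h' : ((8 : ℤ) : ZMod q) = 0 := by
        rw [show (8 : ℤ) = -(-8) by norm_num, Int.cast_neg, h, neg_zero]
      exact_mod_cast h'
    rw [ZMod.natCast_eq_zero_iff] at h8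
    have h23 : q ∣ 2 ^ 3 := by simpa using h8
    exact hq2 ((Nat.prime_dvd_prime_iff_eq hq Nat.prime_two).mp (hq.dvd_of_dvd_pow h23))
  rw [kroneckerBit_eq_addLegendreSym hq hq2 hne]
  have hgcd : Int.gcd 2 q = 1 := by
    have h := Int.gcd_natCast_natCast 2 q
    rw [(Nat.coprime_primes Nat.prime_two hq).mpr (Ne.symm hq2)] at h
    simpa using h
  have hj : jacobiSym (-8) q = jacobiSym (-2) q := by
    rw [show (-8 : ℤ) = 2 ^ 2 * (-2) by norm_num, jacobiSym.mul_left, jacobiSym.pow_left,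
      jacobiSym.sq_one hgcd, one_mul]
  by_cases h57 : q % 8 = 5 ∨ q % 8 = 7
  · rw [if_pos h57]
    apply addLegendreSym_of_eq_neg_one
    rw [hj]; exact jacobiSym_neg_two_eq_neg_one h57
  · rw [if_neg h57]
    have h13 : q % 8 = 1 ∨ q % 8 = 3 := by have := Nat.odd_iff.mp hodd; omega
    apply addLegendreSym_of_eq_one
    rw [hj]; exact jacobiSym_neg_two_eq_one h13

/-- The bit `[x ≡ 5, 7 (mod 8)]` is `χ₈ + χ₄` (`[x ≡ 3,5] + [x ≡ 3 (4)]`) for odd `x`.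
[cite: IrelandRosen1990, Ch. 5 §1 Prop. 5.1.2–5.1.3 ((−2/p) = (−1/p)(2/p))] -/
theorem chi8Bit_add_chi4Bit_eq {x : ℕ} (hx : x % 2 = 1) :
    chi8Bit x + chi4Bit x = if x % 8 = 5 ∨ x % 8 = 7 then 1 else 0 := by
  have h8 : x % 8 = 1 ∨ x % 8 = 3 ∨ x % 8 = 5 ∨ x % 8 = 7 := by omega
  unfold chi8Bit chi4Bit
  rcases h8 with h | h | h | h
  · rw [if_neg (by omega), if_neg (by omega), if_neg (by omega)]; decide
  · rw [if_pos (Or.inl h), if_pos (by omega), if_neg (by omega)]; decide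
  · rw [if_pos (Or.inr h), if_neg (by omega), if_pos (Or.inl h)]; decide
  · rw [if_neg (by omega), if_pos (by omega), if_pos (Or.inr h)]; decide

end Symbols

/-! ## §2 Transfer: the even Monsky matrix IS the reading of the configuration -/

section TransferMonsky

variable {t : ℕ} (p : Fin t → ℕ)

/-- **Monsky's even matrix is a function of the Legendre configuration**: for distinct odd primes
`p₁, …, p_t`, `monskyMatrixEven p = monskyCfgEven (pᵢ mod 8) ([(p_b/p_a) = −1])` — `A`'s entries are the
symbol bits (`kroneckerBit_eq_addLegendreSym`), `D₂ = χ₈` (`addLegendreSym_two_eq`), `D₋₁ = χ₄`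
(`addLegendreSym_neg_one_eq`). [cite: HeathBrown1994SelmerCongruentII, Appendix (Monsky), typescript p. 41 L20–L36]
[cite: IrelandRosen1990, Ch. 5 §1 Prop. 5.1.2–5.1.3] -/
theorem monskyMatrixEven_eq_monskyCfgEven (hp : ∀ i, (p i).Prime) (hp2 : ∀ i, p i ≠ 2)
    (hinj : Function.Injective p) :
    monskyMatrixEven p = monskyCfgEven (fun i => p i % 8) (fun a b => kroneckerBit (p b) (p a)) := by
  have hodd : ∀ i, Odd (p i) := fun i => (hp i).odd_of_ne_two (hp2 i)
  have hA : legendreMatrix p = legendreCfg (fun a b => kroneckerBit (p b) (p a)) := by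
    unfold legendreMatrix legendreCfg
    exact of_rowsum_congr fun a b hab =>
      (kroneckerBit_eq_addLegendreSym (hp a) (hp2 a)
        (intCast_natCast_prime_ne_zero (hp b) (hp a) fun h => hab (hinj h).symm)).symm
  have hD2 : legendreDiagonal p 2 = Matrix.diagonal fun i => chi8Bit (p i % 8) := by
    unfold legendreDiagonal
    congr 1; funext i
    rw [addLegendreSym_two_eq (hodd i), chi8Bit_mod_eight]; rfl
  have hDm1 : legendreDiagonal p (-1) = Matrix.diagonal fun i => chi4Bit (p i % 8) := by
    unfold legendreDiagonal
    congr 1; funext i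
    rw [addLegendreSym_neg_one_eq (hodd i), chi4Bit_mod_eight]; rfl
  unfold monskyMatrixEven monskyCfgEven
  rw [hA, hD2, hDm1]

/-- The kernel count of Monsky's even matrix is the kernel count read on the configuration.
[cite: HeathBrown1994SelmerCongruentII, Appendix (Monsky), typescript p. 41 L36] -/
theorem card_ker_monskyMatrixEven_eq_cfg (hp : ∀ i, (p i).Prime) (hp2 : ∀ i, p i ≠ 2)
    (hinj : Function.Injective p) :
    Fintype.card {v : Fin t ⊕ Fin t → ZMod 2 // monskyMatrixEven p *ᵥ v = 0} =
      Fintype.card {v : Fin t ⊕ Fin t → ZMod 2 //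
        monskyCfgEven (fun i => p i % 8) (fun a b => kroneckerBit (p b) (p a)) *ᵥ v = 0} :=
  Fintype.card_congr (Equiv.subtypeEquivRight fun v => by
    rw [monskyMatrixEven_eq_monskyCfgEven p hp hp2 hinj])

/-- `s(2m) = 1` (Monsky's `2k − rank M`, even case) iff Monsky's even matrix has a `2`-element kernel.
[cite: HeathBrown1994SelmerCongruentII, Appendix (Monsky), typescript p. 41 L36] -/
theorem monskySelmerRankEven_eq_one_iff_card_ker :
    monskySelmerRankEven p = 1 ↔
      Fintype.card {v : Fin t ⊕ Fin t → ZMod 2 // monskyMatrixEven p *ᵥ v = 0} = 2 := by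
  rw [card_ker_mulVec_eq_sum, monskySelmerRankEven]
  constructor
  · intro h; rw [h, pow_one]
  · intro h
    exact Nat.pow_right_injective (le_refl 2) (h.trans (pow_one 2).symm)

end TransferMonsky

/-! ## §3 Transfer: `g(2m)` and `Σ₂′(2p₀p₁p₂)` ARE the readings of the configuration (mod RR) -/

section TransferGenus

variable {m : ℕ}

/-- **Transfer (genus side, even block).** Modulo Rédei–Reichardt (`hR`): for distinct ODD primes
`q₀, …, q_{m−1}`, `g(2·∏ qᵢ) mod 2 = gBitCfgTwo (qᵢ mod 8, [(q_b/q_a) = −1])` — the parity of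
`#2Cl(ℚ(√−2m))` is the Rédei-kernel bit of `RM(−8m)` computed on the configuration (row of `2`:
`[(±8/q_a) = −1]`, column of `2`: `[(D_b/2) = −1] = [q_b ≡ ±3 (8)]`).
[cite: LiMa2008, Thm. 0.4 (p. 280) with Lemma 0.1, Def. 0.2 (p. 279)] [cite: Cox2013, §5.B ((D/2))]
[cite: TianYuanZhang2017, §1 (p0002 L78–L86)] -/
theorem natCast_genusClassNumber_two_mul_eq_gBitCfgTwo (hR : redeiReichardt_fourTwoCard_classGroup)
    (q : Fin m → ℕ) (hq : ∀ i, (q i).Prime) (hq2 : ∀ i, q i ≠ 2) (hinj : Function.Injective q) :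
    ((genusClassNumber (GenusField (2 * ∏ i, q i)) : ℕ) : ZMod 2) =
      gBitCfgTwo (fun i => q i % 8) (fun a b => kroneckerBit (q b) (q a)) := by
  set d := 2 * ∏ i, q i with hd
  have hqodd : ∀ i, Odd (q i) := fun i => (hq i).odd_of_ne_two (hq2 i)
  have hmodd : Odd (∏ i, q i) := Finset.prod_induction _ Odd (fun a b ha hb => ha.mul hb) odd_one
    (fun i _ => hqodd i)
  have hm2 : (∏ i, q i) % 2 = 1 := Nat.odd_iff.mp hmodd
  have hd4 : ¬ d % 4 = 1 := by omega
  -- the prime family of `D = −8m` on `Option (Fin m)`: `none ↦ 2`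
  set qq : Option (Fin m) → ℕ := fun o => o.elim 2 q with hqq
  have hprod : ∏ o, qq o = if d % 4 = 1 then 2 * d else d := by
    rw [if_neg hd4, Fintype.prod_option]; rfl
  have hq' : ∀ o, (qq o).Prime := by
    rintro (_ | a)
    · exact Nat.prime_two
    · exact hq a
  have hinj' : Function.Injective qq := by
    rintro (_ | a) (_ | b) h
    · rfl
    · exact absurd (by simpa [hqq] using h.symm) (hq2 b)
    · exact absurd (by simpa [hqq] using h) (hq2 a)
    · exact congrArg some (hinj (by simpa [hqq] using h))
  have key := odd_genusClassNumber_genusField_iff_card_ker hR qq hq' hinj' hprod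
  -- off-diagonal entries between odd primes
  have hent : ∀ a b : Fin m, a ≠ b → kroneckerBit (primeDisc d (q b)) (q a) =
      redeiEntryCfg (fun i => q i % 8) (fun a b => kroneckerBit (q b) (q a)) a b := by
    intro a b hab
    unfold redeiEntryCfg
    rw [chi4Bit_mod_eight, chi4Bit_mod_eight]
    exact kroneckerBit_primeDisc (hq b) (hq a) (hq2 b) (hq2 a) (fun h => hab (hinj h).symm)
  have h4iff : (∏ i, q i) % 4 = 1 ↔ (∏ i, q i % 8) % 4 = 1 := by rw [← prod_mod_four_eq q]
  have hmat : (Matrix.of fun a b : Option (Fin m) =>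
      if a = b then ∑ c ∈ univ.erase a, kroneckerBit (primeDisc d (qq c)) (qq a)
      else kroneckerBit (primeDisc d (qq b)) (qq a)) =
      redeiCfgTwo (fun i => q i % 8) (fun a b => kroneckerBit (q b) (q a)) := by
    unfold redeiCfgTwo
    apply of_rowsum_congr
    rintro (_ | a) (_ | b) hab
    · exact absurd rfl hab
    · simp only [hqq, Option.elim, redeiEntryCfgTwo]
      rw [chi8Bit_mod_eight]
      exact kroneckerBit_primeDisc_two (hq b) (hq2 b)
    · simp only [hqq, Option.elim, redeiEntryCfgTwo]
      rw [chi8Bit_mod_eight, chi4Bit_mod_eight]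
      by_cases h1 : (∏ i, q i) % 4 = 1
      · -- `m ≡ 1 (mod 4)`: `D₂ = −8`
        have h2 : primeDisc d 2 = -8 := by
          have h6 : ¬ d % 8 = 6 := by omega
          simp [primeDisc, hd4, h6]
        rw [h2, if_pos (h4iff.mp h1), kroneckerBit_neg_eight_eq (hq a) (hq2 a),
          chi8Bit_add_chi4Bit_eq (Nat.odd_iff.mp (hqodd a))]
      · -- `m ≡ 3 (mod 4)`: `D₂ = 8`
        have h3 : (∏ i, q i) % 4 = 3 := by omega
        have h2 : primeDisc d 2 = 8 := by
          have h6 : d % 8 = 6 := by omega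
          simp [primeDisc, hd4, h6]
        rw [h2, if_neg (fun h => h1 (h4iff.mpr h)), kroneckerBit_eight_eq_chi8Bit (hq a) (hq2 a),
          add_zero]
    · simp only [hqq, Option.elim]
      exact hent a b (fun h => hab (congrArg some h))
  have hcard : Fintype.card {v : Option (Fin m) → ZMod 2 // (Matrix.of fun a b : Option (Fin m) =>
      if a = b then ∑ c ∈ univ.erase a, kroneckerBit (primeDisc d (qq c)) (qq a)
      else kroneckerBit (primeDisc d (qq b)) (qq a)) *ᵥ v = 0} =
      Fintype.card {v : Option (Fin m) → ZMod 2 //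
        redeiCfgTwo (fun i => q i % 8) (fun a b => kroneckerBit (q b) (q a)) *ᵥ v = 0} :=
    Fintype.card_congr (Equiv.subtypeEquivRight fun v => by rw [hmat])
  unfold gBitCfgTwo
  rw [natCast_eq_bitOf_of_iff key, hcard]

/-- **Transfer for an even sub-block of a prime triple** (`2·∏ᵢ p_{e i}` for an injective
`e : Fin m → Fin 3`): `g(2·d_T) mod 2 = gBitTwoSub e (configuration of p)`.
[cite: LiMa2008, Thm. 0.4 (p. 280)] [cite: TianYuanZhang2017, §1 (p0002 L78–L86)] -/
theorem natCast_genusClassNumber_two_mul_eq_gBitTwoSub (hR : redeiReichardt_fourTwoCard_classGroup)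
    (p : Fin 3 → ℕ) (hp : ∀ i, (p i).Prime) (hp2 : ∀ i, p i ≠ 2) (hinj : Function.Injective p)
    (e : Fin m → Fin 3) (he : Function.Injective e) :
    ((genusClassNumber (GenusField (2 * ∏ i, p (e i))) : ℕ) : ZMod 2) =
      gBitTwoSub e (fun i => p i % 8) (fun a b => kroneckerBit (p b) (p a)) := by
  unfold gBitTwoSub
  exact natCast_genusClassNumber_two_mul_eq_gBitCfgTwo hR (fun i => p (e i)) (fun i => hp (e i))
    (fun i => hp2 (e i)) (hinj.comp he)

/-- Residue bookkeeping: `(2·(a mod 8)) mod 8 = 2a mod 8`. [cite: HardyWright2008, §5.2 (residues)] -/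
theorem two_mul_mod_eight (a : ℕ) : (2 * (a % 8)) % 8 = (2 * a) % 8 := by omega

/-- Residue bookkeeping: `(2·(a mod 8)·(b mod 8)) mod 8 = 2ab mod 8`. [cite: HardyWright2008, §5.2 (residues)] -/
theorem two_mul_mul_mod_eight (a b : ℕ) : (2 * (a % 8) * (b % 8)) % 8 = (2 * a * b) % 8 := by
  rw [Nat.mul_mod (2 * (a % 8)) (b % 8), Nat.mod_mod, two_mul_mod_eight, ← Nat.mul_mod]

/-- `pat₂` is a function of the residues. [cite: TianYuanZhang2017, Thm. 1.2 (Σ₂)] -/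
theorem pat₂_congr {x x' y y' : ℕ} (hx : x % 8 = x' % 8) (hy : y % 8 = y' % 8) :
    pat₂ x y = pat₂ x' y' := by
  rw [← pat₂_mod x y, hx, hy, pat₂_mod]

/-- `pat₃` is a function of the residues. [cite: TianYuanZhang2017, Thm. 1.2 (Σ₂)] -/
theorem pat₃_congr {x x' y y' z z' : ℕ} (hx : x % 8 = x' % 8) (hy : y % 8 = y' % 8)
    (hz : z % 8 = z' % 8) : pat₃ x y z = pat₃ x' y' z' := by
  rw [← pat₃_mod x y z, hx, hy, hz, pat₃_mod]

/-- `pat₄` is a function of the residues. [cite: TianYuanZhang2017, Thm. 1.2 (Σ₂)] -/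
theorem pat₄_congr {w w' x x' y y' z z' : ℕ} (hw : w % 8 = w' % 8) (hx : x % 8 = x' % 8)
    (hy : y % 8 = y' % 8) (hz : z % 8 = z' % 8) : pat₄ w x y z = pat₄ w' x' y' z' := by
  rw [← pat₄_mod w x y z, hw, hx, hy, hz, pat₄_mod]

variable (p : Fin 3 → ℕ)

/-- **Printed `Σ₂′(2p₀p₁p₂) mod 2` equals `sigma2'CfgEven` of the configuration** (modulo `hR`), for
distinct odd primes with `2p₀p₁p₂ ≡ 6 (mod 8)`: the fifteen-term closed form `natCast_genusSum₂'_four` at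
`q = 2`, each `g`-value transferred to its configuration bit (`gBitSub` odd blocks, `gBitTwoSub` even
blocks), each printed pattern read on residues.
[cite: TianYuanZhang2017, Thm. 1.2 (the second sum for n ≡ 6 (mod 8)); proof of Prop. 3.4 (p0016 L146)]
[cite: LiMa2008, Thm. 0.4] -/
theorem natCast_genusSum₂'_two_mul_three_eq_cfg (hR : redeiReichardt_fourTwoCard_classGroup)
    (hp : ∀ i, (p i).Prime) (hp2 : ∀ i, p i ≠ 2) (hinj : Function.Injective p)
    (h8 : (2 * ∏ i, p i) % 8 = 6) :
    ((genusSum₂' (2 * ∏ i, p i) (fun d => genusClassNumber (GenusField d)) : ℕ) : ZMod 2) =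
      sigma2'CfgEven (fun i => p i % 8) (fun a b => kroneckerBit (p b) (p a)) := by
  have h01 : p 0 ≠ p 1 := fun h => absurd (hinj h) (by decide)
  have h02 : p 0 ≠ p 2 := fun h => absurd (hinj h) (by decide)
  have h12 : p 1 ≠ p 2 := fun h => absurd (hinj h) (by decide)
  have hn : 2 * ∏ i, p i = 2 * p 0 * p 1 * p 2 := by rw [Fin.prod_univ_three]; ring
  have h8' : (2 * p 0 * p 1 * p 2) % 8 = 5 ∨ (2 * p 0 * p 1 * p 2) % 8 = 6 ∨
      (2 * p 0 * p 1 * p 2) % 8 = 7 := Or.inr (Or.inl (hn ▸ h8))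
  -- odd blocks
  have G012 := natCast_genusClassNumber_eq_gBitSub hR p hp hp2 hinj ![0, 1, 2] (by decide)
  have G0 := natCast_genusClassNumber_eq_gBitSub hR p hp hp2 hinj ![0] (by decide)
  have G1 := natCast_genusClassNumber_eq_gBitSub hR p hp hp2 hinj ![1] (by decide)
  have G2 := natCast_genusClassNumber_eq_gBitSub hR p hp hp2 hinj ![2] (by decide)
  have G12 := natCast_genusClassNumber_eq_gBitSub hR p hp hp2 hinj ![1, 2] (by decide)
  have G02 := natCast_genusClassNumber_eq_gBitSub hR p hp hp2 hinj ![0, 2] (by decide)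
  have G01 := natCast_genusClassNumber_eq_gBitSub hR p hp hp2 hinj ![0, 1] (by decide)
  -- even blocks
  have T := natCast_genusClassNumber_two_mul_eq_gBitTwoSub hR p hp hp2 hinj (![] : Fin 0 → Fin 3)
    (fun i => i.elim0)
  have T012 := natCast_genusClassNumber_two_mul_eq_gBitTwoSub hR p hp hp2 hinj ![0, 1, 2] (by decide)
  have T0 := natCast_genusClassNumber_two_mul_eq_gBitTwoSub hR p hp hp2 hinj ![0] (by decide)
  have T1 := natCast_genusClassNumber_two_mul_eq_gBitTwoSub hR p hp hp2 hinj ![1] (by decide)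
  have T2 := natCast_genusClassNumber_two_mul_eq_gBitTwoSub hR p hp hp2 hinj ![2] (by decide)
  have T12 := natCast_genusClassNumber_two_mul_eq_gBitTwoSub hR p hp hp2 hinj ![1, 2] (by decide)
  have T02 := natCast_genusClassNumber_two_mul_eq_gBitTwoSub hR p hp hp2 hinj ![0, 2] (by decide)
  have T01 := natCast_genusClassNumber_two_mul_eq_gBitTwoSub hR p hp hp2 hinj ![0, 1] (by decide)
  have e012 : (∏ i : Fin 3, p ((![0, 1, 2] : Fin 3 → Fin 3) i)) = p 0 * p 1 * p 2 := by
    rw [Fin.prod_univ_three]; rfl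
  have e0 : (∏ i : Fin 1, p ((![0] : Fin 1 → Fin 3) i)) = p 0 := by rw [Fin.prod_univ_one]; rfl
  have e1 : (∏ i : Fin 1, p ((![1] : Fin 1 → Fin 3) i)) = p 1 := by rw [Fin.prod_univ_one]; rfl
  have e2 : (∏ i : Fin 1, p ((![2] : Fin 1 → Fin 3) i)) = p 2 := by rw [Fin.prod_univ_one]; rfl
  have e12 : (∏ i : Fin 2, p ((![1, 2] : Fin 2 → Fin 3) i)) = p 1 * p 2 := by
    rw [Fin.prod_univ_two]; rfl
  have e02 : (∏ i : Fin 2, p ((![0, 2] : Fin 2 → Fin 3) i)) = p 0 * p 2 := by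
    rw [Fin.prod_univ_two]; rfl
  have e01 : (∏ i : Fin 2, p ((![0, 1] : Fin 2 → Fin 3) i)) = p 0 * p 1 := by
    rw [Fin.prod_univ_two]; rfl
  have eT : (2 * ∏ i : Fin 0, p ((![] : Fin 0 → Fin 3) i)) = 2 := by
    rw [Finset.univ_eq_empty, Finset.prod_empty, mul_one]
  rw [e012] at G012
  rw [e0] at G0
  rw [e1] at G1
  rw [e2] at G2
  rw [e12] at G12
  rw [e02] at G02
  rw [e01] at G01
  rw [eT] at T
  rw [e012, show 2 * (p 0 * p 1 * p 2) = 2 * p 0 * p 1 * p 2 by ring] at T012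
  rw [e0] at T0
  rw [e1] at T1
  rw [e2] at T2
  rw [e12, show 2 * (p 1 * p 2) = 2 * p 1 * p 2 by ring] at T12
  rw [e02, show 2 * (p 0 * p 2) = 2 * p 0 * p 2 by ring] at T02
  rw [e01, show 2 * (p 0 * p 1) = 2 * p 0 * p 1 by ring] at T01
  rw [hn, natCast_genusSum₂'_four _ Nat.prime_two (hp 0) (hp 1) (hp 2) (hp2 0).symm (hp2 1).symm
    (hp2 2).symm h01 h02 h12 h8']
  unfold sigma2'CfgEven
  rw [← G012, ← G0, ← G1, ← G2, ← G12, ← G02, ← G01, ← T, ← T012, ← T0, ← T1, ← T2, ← T12, ← T02,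
    ← T01]
  -- the printed patterns read on residues
  have m3 : (p 0 % 8 * (p 1 % 8) * (p 2 % 8)) % 8 = (p 0 * p 1 * p 2) % 8 := mod_eight_mul_three _ _ _
  have m12 : (p 1 % 8 * (p 2 % 8)) % 8 = (p 1 * p 2) % 8 := (Nat.mul_mod _ _ 8).symm
  have m02 : (p 0 % 8 * (p 2 % 8)) % 8 = (p 0 * p 2) % 8 := (Nat.mul_mod _ _ 8).symm
  have m01 : (p 0 % 8 * (p 1 % 8)) % 8 = (p 0 * p 1) % 8 := (Nat.mul_mod _ _ 8).symm
  have r0 : (p 0 % 8) % 8 = p 0 % 8 := Nat.mod_mod _ _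
  have r1 : (p 1 % 8) % 8 = p 1 % 8 := Nat.mod_mod _ _
  have r2 : (p 2 % 8) % 8 = p 2 % 8 := Nat.mod_mod _ _
  rw [pat₂_congr rfl m3, pat₂_congr (two_mul_mod_eight (p 0)) m12,
    pat₂_congr (two_mul_mod_eight (p 1)) m02, pat₂_congr (two_mul_mod_eight (p 2)) m01,
    pat₂_congr (two_mul_mul_mod_eight (p 1) (p 2)) r0, pat₂_congr (two_mul_mul_mod_eight (p 0) (p 2)) r1,
    pat₂_congr (two_mul_mul_mod_eight (p 0) (p 1)) r2,
    pat₃_congr rfl r0 m12, pat₃_congr rfl r1 m02, pat₃_congr rfl r2 m01,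
    pat₃_congr (two_mul_mod_eight (p 0)) r1 r2, pat₃_congr (two_mul_mod_eight (p 1)) r0 r2,
    pat₃_congr (two_mul_mod_eight (p 2)) r0 r1, pat₄_congr rfl r0 r1 r2]

end TransferGenus

end Summit.BirchSwinnertonDyer.Rank1Residual.P2

end
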